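import Summits.KontsevichZagierPeriods.KontsevichZagierPeriods.Theorems.TerasomaMultiplicationGammaHodgeSectorDefs
import Literature.NumberTheory.Transcendental.KZCubeProducts
import Literature.NumberTheory.Transcendental.KZBallPeeling
import Literature.NumberTheory.Transcendental.KZBallVolume
import Literature.NumberTheory.Transcendental.KZGaussMultiplicationChain
import Literature.NumberTheory.Transcendental.KZDirichletScaling
import Summits.KontsevichZagierPeriods.KontsevichZagierPeriods.Theorems.TerasomaMultiplicationGammaHodgeSectorStubBetaRelators

/-!
# `GammaHodgeSector` (stmt-KontsevichZagierPeriods-3742), line `koblitz-ogus-halving` — stub `stub_products`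

The registered stub `stub_products` of the lead skeleton: (i) cube Beta representations are
products of Beta classes; (ii) the ball × cube representation of the crux has class
`κ(c) · β(½,½)^k · Π_l β(x'_l, y'_l)` (`vol B_{2k} = π^k / k!` inside the rules); (iii) the pure-Beta
Gauss multiplication `Π_{k<n} β(k/n,s) = n^{ns−1} Π_{j<n} β(s,js)` in the formal period ring from
`MultiplicationAccessible` (stmt-KontsevichZagierPeriods-12305). All the move engineering lives in
the Literature files `KZCubeProducts`, `KZBallPeeling(Aux)`, `KZBallVolume`,
`KZDirichletPeeling/Scaling`, `KZGaussMultiplicationChain` (landed for this line); here we only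
assemble. The Dirichlet re-association of Beta classes needed by (ii) enters as a hypothesis
`hdir` (`ballCube_of_dir`), discharged from the landed `stub_betaRelators`.
-/

noncomputable section

open MeasureTheory Set
open scoped BigOperators

namespace Summit.KontsevichZagierPeriods.GammaHodgeSectorKO

open Literature.NumberTheory.Transcendental
open Literature.NumberTheory.Transcendental.KZ
open Literature.NumberTheory.Transcendental.BetaSymbol
open Summit.KontsevichZagierPeriods.GammaHodgeSectorNegative (IsCubeBetaRep IsBallCubeRep)
open Summit.KontsevichZagierPeriods.KontsevichZagierPeriods.Theses.TerasomaMultiplication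
  (MultiplicationAccessible)

/-! ## (i) Cube representations are products -/

/-- **Cube representations are products of Beta classes** (first conjunct of `stub_products`):
from `KZ.cubeBetaRep_toFormalPeriod_eq_prod` with the line's `betaRep`s as the pinned factors.
[folklore] -/
theorem cubeProduct_holds ⦃N : ℕ⦄ (x y : Fin N → ℚ) (r : IntegralRep N)
    (hpos : ∀ j, 0 < x j ∧ 0 < y j) (hr : IsCubeBetaRep x y r) :
    toFormalPeriod (of r) = ∏ j, betaClass (x j) (y j) := by
  rw [cubeBetaRep_toFormalPeriod_eq_prod x y hpos r (fun j => betaRep (x j) (y j) (hpos j).1 (hpos j).2)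
    hr.1 hr.2 (fun j => rfl) (fun j => fun _ _ => rfl)]
  exact Finset.prod_congr rfl fun j _ => (betaClass_eq (x j) (y j) (hpos j).1 (hpos j).2).symm

/-! ## (ii) The ball × cube representation -/

/-- `κ(k) = k` in `P` for a natural number `k`. [folklore] -/
theorem kap_natCast (k : ℕ) (hk : IsAlgebraic ℚ (k : ℝ)) : kap (k : ℝ) hk = k :=
  toFormalPeriod_of_unit_constMul_natCast k hk

/-- Dirichlet re-association for PINNED Beta representations, from the identity of Beta classes.
[cite: AndrewsAskeyRoy1999, Thm 1.8.1] -/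
theorem dir_pinned_of_betaClass
    (hdir : ∀ a b c : ℚ, 0 < a → 0 < b → 0 < c →
      betaClass a b * betaClass (a + b) c = betaClass b c * betaClass a (b + c)) :
    ∀ (a b c : ℚ), 0 < a → 0 < b → 0 < c → ∀ (β₁ β₂ β₃ β₄ : IntegralRep 1),
      β₁.domain = {t | t 0 ∈ Set.Ioo (0:ℝ) 1} →
      Set.EqOn β₁.integrand (fun t => (t 0) ^ ((a : ℝ) - 1) * (1 - t 0) ^ ((b : ℝ) - 1)) β₁.domain →
      β₂.domain = {t | t 0 ∈ Set.Ioo (0:ℝ) 1} → Set.EqOn β₂.integrand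
        (fun t => (t 0) ^ (((a + b : ℚ) : ℝ) - 1) * (1 - t 0) ^ ((c : ℝ) - 1)) β₂.domain →
      β₃.domain = {t | t 0 ∈ Set.Ioo (0:ℝ) 1} →
      Set.EqOn β₃.integrand (fun t => (t 0) ^ ((b : ℝ) - 1) * (1 - t 0) ^ ((c : ℝ) - 1)) β₃.domain →
      β₄.domain = {t | t 0 ∈ Set.Ioo (0:ℝ) 1} → Set.EqOn β₄.integrand
        (fun t => (t 0) ^ ((a : ℝ) - 1) * (1 - t 0) ^ (((b + c : ℚ) : ℝ) - 1)) β₄.domain →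
      toFormalPeriod (of β₁) * toFormalPeriod (of β₂) = toFormalPeriod (of β₃) * toFormalPeriod (of β₄) := by
  intro a b c ha hb hc β₁ β₂ β₃ β₄ h1d h1i h2d h2i h3d h3i h4d h4i
  have e1 : toFormalPeriod (of β₁) = betaClass a b := IsBetaRep.toFormalPeriod_eq ha hb ⟨h1d, h1i⟩
  have e2 : toFormalPeriod (of β₂) = betaClass (a + b) c :=
    IsBetaRep.toFormalPeriod_eq (add_pos ha hb) hc ⟨h2d, h2i⟩
  have e3 : toFormalPeriod (of β₃) = betaClass b c := IsBetaRep.toFormalPeriod_eq hb hc ⟨h3d, h3i⟩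
  have e4 : toFormalPeriod (of β₄) = betaClass a (b + c) :=
    IsBetaRep.toFormalPeriod_eq ha (add_pos hb hc) ⟨h4d, h4i⟩
  rw [e1, e2, e3, e4]
  exact hdir a b c ha hb hc

/-- **The ball × cube representation** (second conjunct of `stub_products`, modulo the Dirichlet
re-association of Beta classes): `⟦r'⟧ = κ(c) · β(½,½)^k · Π_l β(x'_l, y'_l)` — `r'` is pointwise
the scaled product `(c·k!)·([B_{2k},1] × cube)`, `k!·⟦B_{2k}⟧ = ⟦β(½,½)⟧^k`
(`KZ.BallPeeling.factorial_mul_toFormalPeriod_ball`), and the cube is a product of Beta classes.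
[cite: KontsevichZagier2001, §1.1] -/
theorem ballCube_of_dir
    (hdir : ∀ a b c : ℚ, 0 < a → 0 < b → 0 < c →
      betaClass a b * betaClass (a + b) c = betaClass b c * betaClass a (b + c))
    ⦃N' : ℕ⦄ (k : ℕ) (x' y' : Fin N' → ℚ) (c : ℝ) (hc : IsAlgebraic ℚ c)
    (r' : IntegralRep (2 * k + N')) (hpos : ∀ l, 0 < x' l ∧ 0 < y' l)
    (hr' : IsBallCubeRep k x' y' c r') :
    toFormalPeriod (of r') =
      kap c hc * betaClass (1 / 2) (1 / 2) ^ k * ∏ l, betaClass (x' l) (y' l) := by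
  classical
  obtain ⟨b, hbd, hbi⟩ := BallPeeling.exists_ballRep (2 * k) 0
  obtain ⟨q, hqd, hqi⟩ := exists_cubeBetaRep x' y' hpos
  have hk : IsAlgebraic ℚ (k.factorial : ℝ) := isAlgebraic_nat k.factorial
  have hb1 : Set.EqOn b.integrand (fun _ => 1) b.domain := fun z _ => by rw [hbi]; simp
  -- `r'` is pointwise the scaled product
  set Q : IntegralRep (2 * k + N') := (b.prod q).constMul (c * k.factorial) (hc.mul hk) with hQ
  have hdom : Q.domain = r'.domain := by
    rw [hr'.1]
    ext z
    simp only [hQ, IntegralRep.domain_constMul, IntegralRep.prod_domain, IntegralRep.prodDomain, hbd,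
      hqd, Set.mem_setOf_eq]
  have heq : Set.EqOn r'.integrand Q.integrand r'.domain := by
    intro z hz
    have hz' : z ∈ Q.domain := hdom ▸ hz
    have hzq : (fun j => z (Fin.natAdd (2 * k) j)) ∈ q.domain := by
      simp only [hQ, IntegralRep.domain_constMul, IntegralRep.prod_domain, IntegralRep.prodDomain,
        Set.mem_setOf_eq] at hz'
      exact hz'.2
    rw [hr'.2 hz]
    simp only [hQ, IntegralRep.integrand_constMul, IntegralRep.prod_integrand_eq, IntegralRep.prodFun,
      hbi, pow_zero, one_mul]
    rw [hqi hzq]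
  have h1 : toFormalPeriod (of r') = toFormalPeriod (of Q) :=
    toFormalPeriod_eq_iff.mpr (of_sub_of_mem_relations_of_eqOn hdom heq)
  -- the pieces
  have hball : (k.factorial : FormalPeriodRing) * toFormalPeriod (of b) = betaClass (1 / 2) (1 / 2) ^ k := by
    rw [betaClass_eq (1 / 2) (1 / 2) (by norm_num) (by norm_num)]
    exact BallPeeling.factorial_mul_toFormalPeriod_ball k b (betaRep (1 / 2) (1 / 2) (by norm_num) (by norm_num))
      hbd hb1 rfl (fun _ _ => rfl) (dir_pinned_of_betaClass hdir)
  have hcube : toFormalPeriod (of q) = ∏ l, betaClass (x' l) (y' l) :=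
    cubeProduct_holds x' y' q hpos ⟨hqd, hqi⟩
  rw [h1, hQ, toFormalPeriod_of_constMul, ← toFormalPeriod_of_mul_of, hcube]
  change kap (c * k.factorial) (hc.mul hk) * (toFormalPeriod (of b) * _) = _
  rw [kap_mul c (k.factorial : ℝ) hc hk, kap_natCast, ← hball]
  ring

/-! ## (iii) Gauss multiplication from `MultiplicationAccessible` -/

/-- **Pure-Beta Gauss multiplication in `P`** (third conjunct of `stub_products`): for `n ≥ 2` and
`s > 0`, `Π_{k<n} β(k/n, s) = n^{ns−1} · Π_{j<n} β(s, js)` — the box ~ simplex equivalence of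
`MultiplicationAccessible` at order `n = m + 1`, the scaling of the simplex and its peeling onto a
product of Beta representations (`KZ.gaussMultiplication_toFormalPeriod`).
[cite: AndrewsAskeyRoy1999, Thm 1.5.2] -/
theorem mult_holds (hM : MultiplicationAccessible) (n : ℕ) (s : ℚ) (hn : 2 ≤ n) (hs : 0 < s) :
    IsConstMultiple (prodClass (multL n s)) (prodClass (multR n s)) := by
  classical
  obtain ⟨m, rfl⟩ : ∃ m, n = m + 1 := ⟨n - 1, by omega⟩
  have hm : 1 ≤ m := by omega
  set xL : Fin m → ℚ := fun i => (((i:ℕ) + 1 : ℕ) : ℚ) / ((m + 1 : ℕ) : ℚ) with hxL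
  set bR : Fin m → ℚ := fun j => (((j:ℕ) + 1 : ℕ) : ℚ) * s with hbR
  have hxpos : ∀ i, 0 < xL i := fun i => by positivity
  have hbpos : ∀ j, 0 < bR j := fun j => by positivity
  have hL : prodClass (multL (m + 1) s) =
      ∏ i : Fin m, toFormalPeriod (of (betaRep (xL i) s (hxpos i) hs)) := by
    simp only [prodClass, multL, Nat.add_sub_cancel, Multiset.map_map, Function.comp_def]
    rw [← Finset.prod_eq_multiset_prod, ← Fin.prod_univ_eq_prod_range]
    refine Finset.prod_congr rfl fun i _ => ?_
    rw [betaClass, dif_pos ⟨hxpos i, hs⟩]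
  have hR : prodClass (multR (m + 1) s) =
      ∏ j : Fin m, toFormalPeriod (of (betaRep s (bR j) hs (hbpos j))) := by
    simp only [prodClass, multR, Nat.add_sub_cancel, Multiset.map_map, Function.comp_def]
    rw [← Finset.prod_eq_multiset_prod, ← Fin.prod_univ_eq_prod_range]
    refine Finset.prod_congr rfl fun j _ => ?_
    rw [betaClass, dif_pos ⟨hs, hbpos j⟩]
  refine ⟨_, isAlgebraic_gaussMultConst m s, gaussMultConst_pos m s, ?_⟩
  rw [hL, hR, kap]
  exact gaussMultiplication_toFormalPeriod m s hs (hM m s hm hs) xL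
    (fun i => by rw [hxL]; push_cast; ring)
    (fun i => betaRep (xL i) s (hxpos i) hs) (fun i => rfl)
    (fun i => fun _ _ => rfl)
    bR (fun j => by rw [hbR]; push_cast; ring) (fun j => betaRep s (bR j) hs (hbpos j))
    (fun j => rfl) (fun j => fun _ _ => rfl)
    (isAlgebraic_gaussMultConst m s)

/-! ## The registered stub -/

/-- **STUB `stub_products` of the `GammaHodgeSector` skeleton (line koblitz-ogus-halving)**:
cube representations are products of Beta classes; the ball × cube representation has class
`κ(c) · β(½,½)^k · Π β(x'_l,y'_l)`; and the pure-Beta Gauss multiplication holds in `P` under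
`MultiplicationAccessible`. [cite: AndrewsAskeyRoy1999, Thm 1.5.2] -/
theorem stub_products :
    (∀ ⦃N : ℕ⦄ (x y : Fin N → ℚ) (r : IntegralRep N), (∀ j, 0 < x j ∧ 0 < y j) →
      IsCubeBetaRep x y r → toFormalPeriod (of r) = ∏ j, betaClass (x j) (y j)) ∧
    (∀ ⦃N' : ℕ⦄ (k : ℕ) (x' y' : Fin N' → ℚ) (c : ℝ) (hc : IsAlgebraic ℚ c)
      (r' : IntegralRep (2 * k + N')), (∀ l, 0 < x' l ∧ 0 < y' l) → IsBallCubeRep k x' y' c r' →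
      toFormalPeriod (of r') = kap c hc * betaClass (1 / 2) (1 / 2) ^ k * ∏ l, betaClass (x' l) (y' l)) ∧
    (MultiplicationAccessible → ∀ (n : ℕ) (s : ℚ), 2 ≤ n → 0 < s →
      IsConstMultiple (prodClass (multL n s)) (prodClass (multR n s))) :=
  ⟨fun _ x y r hpos hr => cubeProduct_holds x y r hpos hr,
   fun _ k x' y' c hc r' hpos hr' => ballCube_of_dir stub_betaRelators.2.2.2.1 k x' y' c hc r' hpos hr',
   fun hM n s hn hs => mult_holds hM n s hn hs⟩

end Summit.KontsevichZagierPeriods.GammaHodgeSectorKO
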